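import Mathlib
import HarnessLib
import Summits.HubbardSuperconductivity.HubbardSuperconductivity.Theorems.KLProgrammeC4aFoldSignedCore

/-!
# Route `KLProgramme` — crux C4a, S3 brick (B4) «(B4)-UMK1», part 6: the FOLD VALUE — in a convex loop window the critical point is the minimiser, and the
# minimum DRIFTS with the level at the rates of `∂_eē` (no implicit function: monotonicity of the minimum)

Cell `gate-hubbard-kl`, seat hubbard-kl-k3c3-p3 (g27; row «implicit-function / monotonicity route for μ(n)»).  Located brick for the (C)-closer lane
hubbard-kl-c4a-1 (stub (C) `stub_twoLeg_curvature` of `KLRegimeEngineV17F2`, stmt-HubbardSuperconductivity-20437), design note HOME/hubbard-kl-k3c3-p3/B4-UMK1-DESIGN.md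
§4 (b′)/§6: the hypotheses `hdrift` of `…C4aFoldLevelLayer.intervalIntegral_fold_first_order_layer_le` (`δ₀ − λ₂e ≤ m(e) ≤ δ₀ − λ₁e`) and «`m(e)` is the value at
the fold point» of `…C4aFoldSignedLaw` are reduced to two monotonicity facts:
* **`le_of_fold_of_convex`**: `g ∈ C²`, `0 ≤ g″` on `[α,β]`, `g′(v*) = 0`, `v* ∈ [α,β]` ⟹ `g(v*) ≤ g(v)` on `[α,β]` (the fold value is the window minimum);
* **`fold_value_drift`**: for a level family `f e v` on `[0,hi] × [α,β]` with a minimiser `v*(e) ∈ [α,β]` at every level and the level rates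
  `−λ₂(e − e′) ≤ f e v − f e′ v ≤ −λ₁(e − e′)` (`e′ ≤ e`, every `v`): `f 0 (v* 0) − λ₂e ≤ f e (v* e) ≤ f 0 (v* 0) − λ₁e` — the minimum inherits the rates.
For the partner band the rates come from `∂_eē = −De_K(P)[∂_eΦ] ∈ [−λ₂, −λ₁]` near the caustic (external tangency: the normals at the loop point and its
partner are parallel, `De_K(Φ(e,α))[∂_eΦ(e,α)] = 1`), typed next.  Pure real analysis.
-/

noncomputable section

namespace Summit.HubbardSuperconductivity.HubbardSuperconductivity.Theorems.C4a

set_option linter.dupNamespace false -- summit = problem name (single-conjunct summit), D-0017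

open Real Set

/-- **In a convex window the fold point is the minimiser**: `g ∈ C²`, `0 ≤ g″` on `[α,β] ∋ v*`, `g′(v*) = 0` ⟹ `g(v*) ≤ g(v)` for `v ∈ [α,β]`. -/
theorem le_of_fold_of_convex {g : ℝ → ℝ} {α β vs : ℝ} (hg : ContDiff ℝ 2 g) (hvs : vs ∈ Icc α β) (hcrit : deriv g vs = 0)
    (hconv : ∀ v ∈ Icc α β, 0 ≤ iteratedDeriv 2 g v) {v : ℝ} (hv : v ∈ Icc α β) : g vs ≤ g v := by
  have hgd : Differentiable ℝ g := hg.differentiable two_ne_zero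
  -- monotonicity of `g′`: `g′(x) − g′(v*) ≥ 0` for `x ≥ v*`
  have hdg : Differentiable ℝ (deriv g) := by
    have h : Differentiable ℝ (iteratedDeriv 1 g) := ContDiff.differentiable_iteratedDeriv 1 hg (by norm_num)
    rwa [iteratedDeriv_one] at h
  have hd2 : ∀ x, deriv (deriv g) x = iteratedDeriv 2 g x := fun x => by
    rw [show iteratedDeriv 2 g = deriv (iteratedDeriv 1 g) from iteratedDeriv_succ, iteratedDeriv_one]
  have hmono : MonotoneOn (deriv g) (Icc α β) :=
    monotoneOn_of_deriv_nonneg (convex_Icc α β) hdg.continuous.continuousOn (hdg.differentiableOn.mono interior_subset)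
      fun x hx => by rw [hd2]; exact hconv x (interior_subset hx)
  rcases le_total vs v with h | h
  · -- `g` is nondecreasing on `[v*, v]`
    have hnn : ∀ x ∈ interior (Icc vs v), 0 ≤ deriv g x := fun x hx => by
      have hx' : x ∈ Icc vs v := interior_subset hx
      have hxI : x ∈ Icc α β := ⟨hvs.1.trans hx'.1, hx'.2.trans hv.2⟩
      have := hmono hvs hxI hx'.1
      rwa [hcrit] at this
    exact (monotoneOn_of_deriv_nonneg (convex_Icc vs v) hgd.continuous.continuousOn (hgd.differentiableOn.mono interior_subset) hnn)
      (left_mem_Icc.2 h) (right_mem_Icc.2 h) h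
  · -- `g` is nonincreasing on `[v, v*]`
    have hnp : ∀ x ∈ interior (Icc v vs), deriv g x ≤ 0 := fun x hx => by
      have hx' : x ∈ Icc v vs := interior_subset hx
      have hxI : x ∈ Icc α β := ⟨hv.1.trans hx'.1, hx'.2.trans hvs.2⟩
      have := hmono hxI hvs hx'.2
      rwa [hcrit] at this
    exact (antitoneOn_of_deriv_nonpos (convex_Icc v vs) hgd.continuous.continuousOn (hgd.differentiableOn.mono interior_subset) hnp)
      (left_mem_Icc.2 h) (right_mem_Icc.2 h) h

/-- **THE FOLD VALUE DRIFTS WITH THE LEVEL** (monotonicity of the minimum; no implicit function).  `f : ℝ → ℝ → ℝ`, a window `[α,β]`, levels `[0,hi]`; at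
every level a minimiser `v*(e) ∈ [α,β]` (`f e (v* e) ≤ f e v` on the window); level rates `−λ₂(e − e′) ≤ f e v − f e′ v ≤ −λ₁(e − e′)` for `0 ≤ e′ ≤ e ≤ hi`,
`v ∈ [α,β]`.  THEN `f 0 (v* 0) − λ₂·e ≤ f e (v* e) ≤ f 0 (v* 0) − λ₁·e` for `e ∈ [0,hi]`. -/
theorem fold_value_drift {f : ℝ → ℝ → ℝ} {vs : ℝ → ℝ} {α β hi la₁ la₂ : ℝ} (hvs : ∀ e ∈ Icc 0 hi, vs e ∈ Icc α β)
    (hmin : ∀ e ∈ Icc 0 hi, ∀ v ∈ Icc α β, f e (vs e) ≤ f e v)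
    (hrate : ∀ e ∈ Icc 0 hi, ∀ e' ∈ Icc 0 hi, e' ≤ e → ∀ v ∈ Icc α β, -la₂ * (e - e') ≤ f e v - f e' v ∧ f e v - f e' v ≤ -la₁ * (e - e'))
    {e : ℝ} (he : e ∈ Icc 0 hi) : f 0 (vs 0) - la₂ * e ≤ f e (vs e) ∧ f e (vs e) ≤ f 0 (vs 0) - la₁ * e := by
  have h0 : (0 : ℝ) ∈ Icc 0 hi := ⟨le_rfl, he.1.trans he.2⟩
  constructor
  · -- lower: `f e (v* e) ≥ f 0 (v* e) − λ₂ e ≥ f 0 (v* 0) − λ₂ e`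
    have h1 := (hrate e he 0 h0 he.1 (vs e) (hvs e he)).1
    have h2 := hmin 0 h0 (vs e) (hvs e he)
    linarith
  · -- upper: `f e (v* e) ≤ f e (v* 0) ≤ f 0 (v* 0) − λ₁ e`
    have h1 := (hrate e he 0 h0 he.1 (vs 0) (hvs 0 h0)).2
    have h2 := hmin e he (vs 0) (hvs 0 h0)
    linarith

end Summit.HubbardSuperconductivity.HubbardSuperconductivity.Theorems.C4a

end
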